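/-
Copyright (c) 2026 the pub-hodgecm-mathlib formalisation cell (harness21).  Prover seat hodgecm-mathlib-K2Liu-p01 (g2): Track B «K2-LIT»,
#184♮ = hLiu418 = stmt-HodgeConjecture-24832, STEWARD of socket #41; organ O41.5 (Gindikin–Karpelevich), ROADMAP
`K2/K2Liu-p01/g2/ROADMAP-O41_5-GindikinKarpelevich.K2Liup01g2.md` a6873eb1b770b760, sub-organ O41.5c∕d at rank one.
-/
import Literature.NumberTheory.GelbartRogawski1991.LocalDoubledUnitaryUnramifiedCell   -- ★ `nElem`, `IsIntegralAt`
import Literature.NumberTheory.GelbartRogawski1991.LocalUnitaryIntegralLattice          -- ★ `valuation_le_one_iff_valued`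
import Literature.NumberTheory.K2Lit.LocalSiegelIntertwining                          -- ★ D10 `unipDeltaLocal`
import Summits.HodgeConjecture.HodgeConjecture.Theorems.K2LiuUnipDeltaLocalCoordinates  -- ★ O41.5c `eq_nElem_of_mem_unipDeltaLocal`, `nElem_add`, …
import Summits.HodgeConjecture.HodgeConjecture.Theorems.K2LiuSiegelWeylUnipotentIwasawa -- ★ O41.5b `IsSphericalSection.apply_weylDelta_mul_nElem(_of_integral)`
import HarnessLib

/-!
# Crux `HLiu418`, road `K2_Liu`, socket #41, organ O41.5 at RANK ONE: the coordinate `b ↦ n(ι_v b · δ)` identifies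
# `(F_v, +) ≅ N_Δ(F_v)` for `H = U(1,1)`, and `N_Δ(F_v) ∩ H(𝒪_v)` is the image of `𝒪_v`

Cell `hodgecm-mathlib`, crux item hLiu418 = `stmt-HodgeConjecture-24832`; squad K2 ∕ K2Liu; prover K2Liu-p01 (g2), steward of #41.
THEOREMS ONLY (no `def`, no instance, no notation, no named-fact hypothesis, no `sorry`); lane `--supports stmt-HodgeConjecture-24832`.

At rank `n = 1` (`H(F_v) = U(T₀ ⊕ −T₀)(F_v)` with `T₀` a non-zero `1 × 1` matrix) a `T₀`-skew `1 × 1` matrix over `E ⊗ F_v` is exactly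
an entry `x` with `σ x = −x` (§2 `skew_iff_conjLocal_apply_eq_neg`), i.e. `x = ι_v b · δ` for a unique `b ∈ F_v` (§1, quadratic coordinates
★ `existsUnique_eq_add_mul`).  Hence (§3) every `u ∈ N_Δ(F_v)` is `n(ι_v b · δ)` for a unique `b ∈ F_v` (`existsUnique_eq_nElem_coord`), the
coordinate is additive (`nElem_coord_add`, `nElem_coord_zero`, `nElem_coord_injective`), and (§4) at a place where `2` and `δ` are units,
**`n(ι_v b · δ) ∈ H(𝒪_v) ↔ |b|_v ≤ 1`** (`nElem_coord_mem_localInt_iff`).  This is the change of variables of the RANK-ONE Gindikin–Karpelevich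
integral `∫_{N_Δ(F_v)} φ°(w_Δ u) du = ∫_{F_v} φ°(w_Δ n(ι_v b δ)) db` (ROADMAP O41.5d, `U(1,1)` case; engine ★ `K2LiuGKRankOneIntegral`) and it
fixes the normalising volume `ν_N(N_Δ ∩ K_v) = μ(𝒪_v)`.  [HarrisKudlaSweet1996, §1 (1.11)–(1.12), §6 (6.14)–(6.16)] [Kudla1994, §3] [Casselman1980, §3].
HONEST LABEL.  Count-neutral helper; it retires nothing by itself: `HC_CM` is proved only modulo the 7 printed citations (2 remaining named inputs:
hLiu418 = `stmt-HodgeConjecture-24832`, h413 = `stmt-HodgeConjecture-24833`) until rung 0 closes.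

## References
* [HarrisKudlaSweet1996] M. Harris, S. Kudla, W. J. Sweet, J. AMS 9 (1996): §1 (1.11)–(1.12), §6 (6.14)–(6.16).
* [Kudla1994] S. S. Kudla, Israel J. Math. 87 (1994): §3.   * [Casselman1980] W. Casselman, Compositio Math. 40 (1980): §3.
* [CasselsFrohlichANT1967] J. W. S. Cassels, A. Fröhlich (eds.), *Algebraic Number Theory* (1967): Ch. II §10.
-/

set_option autoImplicit false
set_option linter.dupNamespace false -- the mandated namespace repeats `HodgeConjecture.HodgeConjecture`

noncomputable section

open NumberField IsDedekindDomain Matrix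
open scoped ValuativeRel
open Literature.NumberTheory.Automorphic Literature.NumberTheory.Automorphic.UnitaryGroup
open Literature.NumberTheory.GelbartRogawski1991.AdaptedBlocks
open Literature.NumberTheory.GelbartRogawski1991.UnitaryDualPair.LocalSplitting
open Literature.NumberTheory.K2Lit.LocalSiegelDoubled
open Summit.HodgeConjecture.HodgeConjecture.Cruxes.HLiu418.K2LiuUnipDeltaLocalCoordinates
open Summit.HodgeConjecture.HodgeConjecture.Cruxes.HLiu418.K2LiuSiegelWeylUnipotentIwasawa

namespace Summit.HodgeConjecture.HodgeConjecture.Cruxes.HLiu418.K2LiuUnipDeltaRankOneCoordinates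

variable (F : Type) [Field F] [NumberField F] (E : Type) [Field E] [NumberField E] [Algebra F E]
  [Algebra.IsQuadraticExtension F E] (c : E ≃ₐ[F] E) {δ : E} (hcδ : c δ = -δ) (hδ : δ ≠ 0) {d : F} (hd : δ * δ = algebraMap F E d)
  (v : HeightOneSpectrum (𝓞 F)) {T₀ : Matrix (Fin 1) (Fin 1) F} (hT₀ : T₀.IsSymm) (hT₀d : IsUnit T₀.det)
  {JD : Matrix (Fin (1 + 1)) (Fin (1 + 1)) E} (hJD : JD = (gramD F 1 T₀).map (algebraMap F E))

/-! ## §1 Anti-invariant elements of `E ⊗ F_v` are `ι_v b · δ` -/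

omit [Algebra.IsQuadraticExtension F E] in
include hcδ in
/-- `σ (ι_v b · δ) = −(ι_v b · δ)`. [cite: CasselsFrohlichANT1967, Ch. II §10] -/
theorem conjLocal_coord (b : v.adicCompletion F) :
    conjLocal E c v (toLocalRing E v b * algebraMap E (LocalRing E v) δ) = -(toLocalRing E v b * algebraMap E (LocalRing E v) δ) := by
  rw [map_mul, conjLocal_toLocalRing, conjLocal_algebraMap, hcδ, map_neg, mul_neg]

omit [NumberField F] [Algebra.IsQuadraticExtension F E] in
/-- `δ ⊗ 1` is a unit of `E ⊗ F_v`. [cite: CasselsFrohlichANT1967, Ch. II §10] -/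
theorem isUnit_algebraMap_delta (hδ : δ ≠ 0) : IsUnit (algebraMap E (LocalRing E v) δ) := (isUnit_iff_ne_zero.2 hδ).map _

omit [Algebra.IsQuadraticExtension F E] in
/-- the coordinate `b ↦ ι_v b · δ` is injective. [cite: CasselsFrohlichANT1967, Ch. II §10] -/
theorem coord_injective (hδ : δ ≠ 0) {b b' : v.adicCompletion F}
    (h : toLocalRing E v b * algebraMap E (LocalRing E v) δ = toLocalRing E v b' * algebraMap E (LocalRing E v) δ) : b = b' :=
  toLocalRing_injective E v ((isUnit_algebraMap_delta F E v hδ).mul_left_injective h)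

include hcδ hδ in
/-- **`σ x = −x` iff `x = ι_v b · δ` for a (unique) `b ∈ F_v`** (quadratic coordinates `x = ι_v a + ι_v b · δ`, `σ` fixes `ι_v` and negates `δ`;
`2 ι_v a = 0 ⇒ a = 0` in characteristic `0`). [cite: CasselsFrohlichANT1967, Ch. II §10] -/
theorem existsUnique_coord_of_conjLocal_eq_neg {x : LocalRing E v} (hx : conjLocal E c v x = -x) :
    ∃! b : v.adicCompletion F, x = toLocalRing E v b * algebraMap E (LocalRing E v) δ := by
  obtain ⟨⟨a, b⟩, hab, -⟩ := existsUnique_eq_add_mul E v c hcδ hδ x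
  dsimp only at hab
  have hσ : conjLocal E c v x = toLocalRing E v a - toLocalRing E v b * algebraMap E (LocalRing E v) δ := by
    rw [hab, map_add, conjLocal_coord F E c hcδ v b, conjLocal_toLocalRing, sub_eq_add_neg]
  have ha2 : toLocalRing E v (a + a) = 0 := by
    rw [map_add]
    linear_combination hσ.symm.trans (hx.trans (congrArg Neg.neg hab))
  haveI : CharZero (v.adicCompletion F) := charZero_of_injective_algebraMap (algebraMap F (v.adicCompletion F)).injective
  have ha : a = 0 := by
    have h := toLocalRing_injective E v (ha2.trans (map_zero _).symm)
    rwa [← two_mul, mul_eq_zero, or_iff_right (two_ne_zero' (v.adicCompletion F))] at h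
  refine ⟨b, ?_, fun b' hb' => coord_injective F E v hδ (hb'.symm.trans ?_)⟩
  · rw [hab, ha, map_zero, zero_add]
  · rw [hab, ha, map_zero, zero_add]

/-! ## §2 Rank one: a `1 × 1` matrix is `T₀`-skew iff its entry is anti-invariant -/

omit [Algebra.IsQuadraticExtension F E] in
/-- a `1 × 1` matrix vanishes iff its entry does. [folklore] -/
theorem fin_one_eq_zero_iff {R : Type*} [Zero R] (M : Matrix (Fin 1) (Fin 1) R) : M = 0 ↔ M 0 0 = 0 :=
  ⟨fun h => by rw [h, Matrix.zero_apply], fun h => Matrix.ext fun i j => by rw [Fin.fin_one_eq_zero i, Fin.fin_one_eq_zero j, h, Matrix.zero_apply]⟩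

omit [Algebra.IsQuadraticExtension F E] in
include hT₀d in
/-- **rank one: `t` is `T₀`-skew iff `σ(t₀₀) = −t₀₀`** (`σ(t₀₀) τ + τ t₀₀ = (σ t₀₀ + t₀₀) τ` with `τ = T₀ ⊗ 1` a unit).
[cite: HarrisKudlaSweet1996, §1 (1.12)] [cite: Kudla1994, §3] -/
theorem skew_iff_conjLocal_apply_eq_neg (t : Matrix (Fin 1) (Fin 1) (LocalRing E v)) :
    (t.map (conjLocal E c v))ᵀ * gramS F E v 1 T₀ + gramS F E v 1 T₀ * t = 0 ↔ conjLocal E c v (t 0 0) = -(t 0 0) := by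
  have hτ : IsUnit (gramS F E v 1 T₀ 0 0) := by
    have h := isUnit_det_gramS' F E v 1 hT₀d
    rwa [Matrix.det_fin_one] at h
  rw [fin_one_eq_zero_iff, Matrix.add_apply, Matrix.mul_apply, Matrix.mul_apply, Fin.sum_univ_one, Fin.sum_univ_one, Matrix.transpose_apply,
    Matrix.map_apply, mul_comm (gramS F E v 1 T₀ 0 0) (t 0 0), ← add_mul, hτ.mul_left_eq_zero, eq_neg_iff_add_eq_zero]

omit [Algebra.IsQuadraticExtension F E] in
include hcδ hT₀d in
/-- **the coordinate matrix `(ι_v b · δ)` is `T₀`-skew.** [cite: HarrisKudlaSweet1996, §1 (1.12)] -/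
theorem skew_coord (b : v.adicCompletion F) :
    ((Matrix.of fun _ _ : Fin 1 => toLocalRing E v b * algebraMap E (LocalRing E v) δ).map (conjLocal E c v))ᵀ * gramS F E v 1 T₀ +
      gramS F E v 1 T₀ * (Matrix.of fun _ _ : Fin 1 => toLocalRing E v b * algebraMap E (LocalRing E v) δ) = 0 := by
  rw [skew_iff_conjLocal_apply_eq_neg F E c v hT₀d, Matrix.of_apply]
  exact conjLocal_coord F E c hcδ v b

include hcδ hδ hT₀d in
/-- **every `T₀`-skew `1 × 1` matrix is a coordinate matrix `(ι_v b · δ)`, for a unique `b`.** [cite: HarrisKudlaSweet1996, §1 (1.12)] -/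
theorem existsUnique_coord_of_skew {t : Matrix (Fin 1) (Fin 1) (LocalRing E v)}
    (ht : (t.map (conjLocal E c v))ᵀ * gramS F E v 1 T₀ + gramS F E v 1 T₀ * t = 0) :
    ∃! b : v.adicCompletion F, t = Matrix.of fun _ _ : Fin 1 => toLocalRing E v b * algebraMap E (LocalRing E v) δ := by
  obtain ⟨b, hb, -⟩ := existsUnique_coord_of_conjLocal_eq_neg F E c hcδ hδ v ((skew_iff_conjLocal_apply_eq_neg F E c v hT₀d t).1 ht)
  refine ⟨b, Matrix.ext fun i j => ?_, fun b' hb' => coord_injective F E v hδ ?_⟩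
  · rw [Fin.fin_one_eq_zero i, Fin.fin_one_eq_zero j, Matrix.of_apply, ← hb]
  · rw [← Matrix.of_apply (fun _ _ : Fin 1 => toLocalRing E v b' * algebraMap E (LocalRing E v) δ) 0 0, ← hb', hb]

/-! ## §3 `b ↦ n(ι_v b · δ)` is an isomorphism `(F_v, +) ≅ N_Δ(F_v)` -/

omit [Algebra.IsQuadraticExtension F E] in
include hJD in
/-- `n(t)` only depends on `t` (proof-irrelevance helper for rewriting the coordinate). [folklore] -/
theorem nElem_congr {t t' : Matrix (Fin 1) (Fin 1) (LocalRing E v)} (h : t = t')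
    (ht : (t.map (conjLocal E c v))ᵀ * gramS F E v 1 T₀ + gramS F E v 1 T₀ * t = 0)
    (ht' : (t'.map (conjLocal E c v))ᵀ * gramS F E v 1 T₀ + gramS F E v 1 T₀ * t' = 0) :
    nElem F E c v 1 hJD t ht = nElem F E c v 1 hJD t' ht' := by
  subst h
  rfl

include hcδ hδ hT₀d hJD in
/-- **every `u ∈ N_Δ(F_v)` is `n(ι_v b · δ)` for a unique `b ∈ F_v`** (`H = U(1,1)`). [cite: HarrisKudlaSweet1996, §1 (1.11)–(1.12)] [cite: Kudla1994, §3] -/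
theorem existsUnique_eq_nElem_coord {u : UnitaryGroup.localPi E c (1 + 1) JD v} (hu : u ∈ unipDeltaLocal F E c v 1 (JD := JD)) :
    ∃! b : v.adicCompletion F,
      u = nElem F E c v 1 hJD (Matrix.of fun _ _ : Fin 1 => toLocalRing E v b * algebraMap E (LocalRing E v) δ) (skew_coord F E c hcδ v hT₀d b) := by
  obtain ⟨b, hb, -⟩ := existsUnique_coord_of_skew F E c hcδ hδ v hT₀d (skew_blkB_of_mem_unipDeltaLocal F E c v 1 hJD hu)
  refine ⟨b, (eq_nElem_of_mem_unipDeltaLocal F E c v 1 hJD hu).trans (nElem_congr F E c v hJD hb _ _), fun b' hb' => ?_⟩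
  refine coord_injective F E v hδ ?_
  have h := nElem_injective F E c v 1 hJD (skew_coord F E c hcδ v hT₀d b') (skew_coord F E c hcδ v hT₀d b)
    (hb'.symm.trans ((eq_nElem_of_mem_unipDeltaLocal F E c v 1 hJD hu).trans (nElem_congr F E c v hJD hb _ _)))
  simpa only [Matrix.of_apply] using congrFun (congrFun h 0) 0

omit [Algebra.IsQuadraticExtension F E] in
include hcδ hT₀d hJD in
/-- **`n(ι_v (b + b') · δ) = n(ι_v b · δ) · n(ι_v b' · δ)`**: the coordinate is additive. [cite: HarrisKudlaSweet1996, §1 (1.11)] -/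
theorem nElem_coord_add (b b' : v.adicCompletion F) :
    nElem F E c v 1 hJD (Matrix.of fun _ _ : Fin 1 => toLocalRing E v (b + b') * algebraMap E (LocalRing E v) δ) (skew_coord F E c hcδ v hT₀d (b + b')) =
      nElem F E c v 1 hJD (Matrix.of fun _ _ : Fin 1 => toLocalRing E v b * algebraMap E (LocalRing E v) δ) (skew_coord F E c hcδ v hT₀d b) *
        nElem F E c v 1 hJD (Matrix.of fun _ _ : Fin 1 => toLocalRing E v b' * algebraMap E (LocalRing E v) δ) (skew_coord F E c hcδ v hT₀d b') := by
  rw [← nElem_add F E c v 1 hJD]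
  refine nElem_congr F E c v hJD (Matrix.ext fun i j => ?_) _ _
  rw [Matrix.add_apply, Matrix.of_apply, Matrix.of_apply, Matrix.of_apply, map_add, add_mul]

omit [Algebra.IsQuadraticExtension F E] in
include hcδ hT₀d hJD in
/-- **`n(ι_v 0 · δ) = 1`.** [cite: HarrisKudlaSweet1996, §1 (1.11)] -/
theorem nElem_coord_zero :
    nElem F E c v 1 hJD (Matrix.of fun _ _ : Fin 1 => toLocalRing E v 0 * algebraMap E (LocalRing E v) δ) (skew_coord F E c hcδ v hT₀d 0) = 1 := by
  rw [← nElem_zero' F E c v 1 hJD]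
  refine nElem_congr F E c v hJD (Matrix.ext fun i j => ?_) _ _
  rw [Matrix.of_apply, map_zero, zero_mul, Matrix.zero_apply]

omit [Algebra.IsQuadraticExtension F E] in
include hcδ hδ hT₀d hJD in
/-- **`b ↦ n(ι_v b · δ)` is injective.** [cite: Kudla1994, §3] -/
theorem nElem_coord_injective {b b' : v.adicCompletion F}
    (h : nElem F E c v 1 hJD (Matrix.of fun _ _ : Fin 1 => toLocalRing E v b * algebraMap E (LocalRing E v) δ) (skew_coord F E c hcδ v hT₀d b) =
      nElem F E c v 1 hJD (Matrix.of fun _ _ : Fin 1 => toLocalRing E v b' * algebraMap E (LocalRing E v) δ) (skew_coord F E c hcδ v hT₀d b')) : b = b' := by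
  have h' := nElem_injective F E c v 1 hJD _ _ h
  exact coord_injective F E v hδ (by simpa only [Matrix.of_apply] using congrFun (congrFun h' 0) 0)

omit [Algebra.IsQuadraticExtension F E] in
include hcδ hT₀d hJD in
/-- `n(ι_v b · δ) ∈ N_Δ(F_v)`. [cite: HarrisKudlaSweet1996, §1 (1.11)] -/
theorem nElem_coord_mem_unipDeltaLocal (b : v.adicCompletion F) :
    nElem F E c v 1 hJD (Matrix.of fun _ _ : Fin 1 => toLocalRing E v b * algebraMap E (LocalRing E v) δ) (skew_coord F E c hcδ v hT₀d b) ∈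
      unipDeltaLocal F E c v 1 (JD := JD) :=
  nElem_mem_unipDeltaLocal F E c v 1 hJD _ _

/-! ## §4 Integrality: `n(ι_v b · δ) ∈ H(𝒪_v) ↔ |b|_v ≤ 1` -/

omit [Algebra.IsQuadraticExtension F E] in
/-- the `w`-component of `ι_v b · δ` is `ι_w b · δ`. [cite: CasselsFrohlichANT1967, Ch. II §10] -/
theorem coord_apply (b : v.adicCompletion F) (w : PlacesOver E v) :
    (toLocalRing E v b * algebraMap E (LocalRing E v) δ) w = toPlace v w b * ((δ : E) : w.1.adicCompletion E) := by
  rw [Pi.mul_apply, toLocalRing_apply, Pi.algebraMap_apply]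
  rfl

omit [Algebra.IsQuadraticExtension F E] in
/-- **`|ι_w b · δ|_w ≤ 1 ↔ |b|_v ≤ 1`** when `δ` is a `w`-unit (`|ι_w b|_w = |b|_v^{e(w|v)}`, `e ≥ 1`). [cite: CasselsFrohlichANT1967, Ch. II §10] -/
theorem valuation_coord_le_one_iff (w : PlacesOver E v) (hδw : Valued.v ((δ : E) : w.1.adicCompletion E) = 1) (b : v.adicCompletion F) :
    ValuativeRel.valuation (w.1.adicCompletion E) ((toLocalRing E v b * algebraMap E (LocalRing E v) δ) w) ≤ 1 ↔ Valued.v b ≤ 1 := by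
  haveI := PlacesOver.liesOver w
  rw [valuation_le_one_iff_valued, coord_apply, map_mul, hδw, mul_one, valued_toPlace]
  exact pow_le_one_iff (Ideal.IsDedekindDomain.ramificationIdx'_ne_zero_of_liesOver w.1.asIdeal v.ne_bot)

omit [Algebra.IsQuadraticExtension F E] in
/-- **the coordinate matrix `(ι_v b · δ)` is integral at `w` iff `|b|_v ≤ 1`** (`δ` a `w`-unit). [cite: CasselsFrohlichANT1967, Ch. II §10] -/
theorem isIntegralAt_coord_iff (w : PlacesOver E v) (hδw : Valued.v ((δ : E) : w.1.adicCompletion E) = 1) (b : v.adicCompletion F) :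
    IsIntegralAt F E v w (Matrix.of fun _ _ : Fin 1 => toLocalRing E v b * algebraMap E (LocalRing E v) δ) ↔ Valued.v b ≤ 1 := by
  rw [isIntegralAt_iff]
  refine ⟨fun h => (valuation_coord_le_one_iff F E v w hδw b).1 (by simpa only [Matrix.of_apply] using h 0 0), fun h i j => ?_⟩
  rw [Matrix.of_apply]
  exact (valuation_coord_le_one_iff F E v w hδw b).2 h

omit [Algebra.IsQuadraticExtension F E] in
include hcδ hT₀d hJD in
/-- **`n(ι_v b · δ) ∈ H(𝒪_v) ↔ |b|_v ≤ 1`** at a place `v` where `2` and `δ` are units at every `w ∣ v`: under the coordinate `b ↦ n(ι_v b · δ)`,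
**`N_Δ(F_v) ∩ K_v` is the image of `𝒪_v`** — the normalising volume `ν_N(N_Δ ∩ K_v) = μ(𝒪_v)` of the rank-one Gindikin–Karpelevich identity.
[cite: HarrisKudlaSweet1996, §6 (6.14)–(6.16)] [cite: Casselman1980, §3] -/
theorem nElem_coord_mem_localInt_iff (h2 : ∀ w : PlacesOver E v, ValuativeRel.valuation (w.1.adicCompletion E) (2 : w.1.adicCompletion E) = 1)
    (hδw : ∀ w : PlacesOver E v, Valued.v ((δ : E) : w.1.adicCompletion E) = 1) (b : v.adicCompletion F) :
    nElem F E c v 1 hJD (Matrix.of fun _ _ : Fin 1 => toLocalRing E v b * algebraMap E (LocalRing E v) δ) (skew_coord F E c hcδ v hT₀d b) ∈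
        UnitaryGroup.localInt E c (1 + 1) JD v ↔ Valued.v b ≤ 1 := by
  rw [mem_localInt_iff_isIntegralAt_blkB F E c v 1 hJD h2 (nElem_coord_mem_unipDeltaLocal F E c hcδ v hT₀d hJD b), blkB_matA_nElem]
  obtain ⟨w₀⟩ := PlacesOver.nonempty E v
  exact ⟨fun h => (isIntegralAt_coord_iff F E v w₀ (hδw w₀) b).1 (h w₀), fun h w => (isIntegralAt_coord_iff F E v w (hδw w) b).2 h⟩

/-! ## §5 The integrand of the rank-one Gindikin–Karpelevich integral: `φ°(w_Δ n(ι_v b · δ))` -/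

include hcδ hT₀d hJD in
/-- **`|b|_v ≤ 1 ⇒ φ°(w_Δ · n(ι_v b · δ)) = 1`** for a spherical section `φ°` (`w_Δ n(X) ∈ K_v` for integral `X`, ★ O41.5b).
[cite: HarrisKudlaSweet1996, §6 (6.14)–(6.16)] [cite: Casselman1980, §3] -/
theorem apply_weylDelta_mul_nElem_coord_of_le_one (χv : ∀ w : PlacesOver E v, (w.1.adicCompletion E)ˣ →* ℂˣ) (s : ℂ)
    {φ : UnitaryGroup.localPi E c (1 + 1) JD v → ℂ} (hφ : IsSphericalSection F E c hcδ hδ hd v 1 hT₀ hJD χv s φ)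
    (h2 : ∀ w : PlacesOver E v, ValuativeRel.valuation (w.1.adicCompletion E) (2 : w.1.adicCompletion E) = 1)
    (hδw : ∀ w : PlacesOver E v, Valued.v ((δ : E) : w.1.adicCompletion E) = 1) {b : v.adicCompletion F} (hb : Valued.v b ≤ 1) :
    φ (weylDelta F E c v 1 hJD *
        nElem F E c v 1 hJD (Matrix.of fun _ _ : Fin 1 => toLocalRing E v b * algebraMap E (LocalRing E v) δ) (skew_coord F E c hcδ v hT₀d b)) = 1 :=
  IsSphericalSection.apply_weylDelta_mul_nElem_of_integral F E c hcδ hδ hd v 1 hT₀ hJD χv s hφ _ _ h2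
    fun w => (isIntegralAt_coord_iff F E v w (hδw w) b).2 hb

omit [Algebra.IsQuadraticExtension F E] in
/-- for `b ≠ 0` the coordinate matrix is invertible with inverse the coordinate matrix of `(b⁻¹, δ⁻¹)`:
`(ι_v b · δ)⁻¹ = (ι_v b⁻¹ · δ⁻¹)`. [folklore] -/
theorem coord_inv (hδ : δ ≠ 0) {b : v.adicCompletion F} (hb : b ≠ 0) :
    (Matrix.of fun _ _ : Fin 1 => toLocalRing E v b * algebraMap E (LocalRing E v) δ)⁻¹ =
      Matrix.of fun _ _ : Fin 1 => toLocalRing E v b⁻¹ * algebraMap E (LocalRing E v) δ⁻¹ := by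
  refine Matrix.inv_eq_left_inv (Matrix.ext fun i j => ?_)
  rw [Matrix.mul_apply, Fin.sum_univ_one, Matrix.of_apply, Matrix.of_apply, Fin.fin_one_eq_zero i, Fin.fin_one_eq_zero j, Matrix.one_apply_eq,
    mul_mul_mul_comm, ← map_mul, ← map_mul, inv_mul_cancel₀ hb, inv_mul_cancel₀ hδ, map_one, map_one, mul_one]

omit [Algebra.IsQuadraticExtension F E] in
/-- the determinant of the coordinate matrix is its entry, a unit for `b ≠ 0`. [folklore] -/
theorem isUnit_det_coord (hδ : δ ≠ 0) {b : v.adicCompletion F} (hb : b ≠ 0) :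
    IsUnit (Matrix.of fun _ _ : Fin 1 => toLocalRing E v b * algebraMap E (LocalRing E v) δ).det := by
  rw [Matrix.det_fin_one, Matrix.of_apply]
  exact ((isUnit_iff_ne_zero.2 hb).map _).mul (isUnit_algebraMap_delta F E v hδ)

include hcδ hT₀d hJD in
/-- **`|b|_v ≥ 1 ⇒ φ°(w_Δ · n(ι_v b · δ)) = χ_v(det_Δ p)|det_Δ p|_v^{s + 1/2}` for a `p ∈ P_Δ(F_v)` with `det_Δ(p)_w = −ι_w(b⁻¹) · δ⁻¹`** at every
`w ∣ v` (the rank-one Iwasawa factorisation `w_Δ n(X) = p(X) k(X)` of ★ O41.5b with `X = (ι_v b · δ)`, `X⁻¹ = (ι_v b⁻¹ · δ⁻¹)` integral, `det_Δ p(X) = −X⁻¹`).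
With `χ` unramified and `|δ|_w = 1` this is `χ_v(b)⁻¹ |b|_v^{−(2s+1)}` — the shell profile fed to ★ `K2LiuGKRankOneIntegral.integrable_and_integral_eq_of_shells`.
[cite: HarrisKudlaSweet1996, §6 (6.14)–(6.16)] [cite: Casselman1980, §3] [cite: Kudla1994, §3] -/
theorem apply_weylDelta_mul_nElem_coord_of_one_le (χv : ∀ w : PlacesOver E v, (w.1.adicCompletion E)ˣ →* ℂˣ) (s : ℂ)
    {φ : UnitaryGroup.localPi E c (1 + 1) JD v → ℂ} (hφ : IsSphericalSection F E c hcδ hδ hd v 1 hT₀ hJD χv s φ)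
    (h2 : ∀ w : PlacesOver E v, ValuativeRel.valuation (w.1.adicCompletion E) (2 : w.1.adicCompletion E) = 1)
    (hδw : ∀ w : PlacesOver E v, Valued.v ((δ : E) : w.1.adicCompletion E) = 1) {b : v.adicCompletion F} (hb : 1 ≤ Valued.v b) :
    ∃ p : UnitaryGroup.localPi E c (1 + 1) JD v, IsSiegelDelta F E c hcδ hδ hd v 1 hT₀ hJD p ∧
      (∀ w : PlacesOver E v, detDelta F E c v 1 w p = -(toPlace v w b⁻¹ * ((δ⁻¹ : E) : w.1.adicCompletion E))) ∧
      φ (weylDelta F E c v 1 hJD *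
          nElem F E c v 1 hJD (Matrix.of fun _ _ : Fin 1 => toLocalRing E v b * algebraMap E (LocalRing E v) δ) (skew_coord F E c hcδ v hT₀d b)) =
        localSiegelCharacter F E c v 1 χv s p := by
  have hb0 : b ≠ 0 := fun h => not_lt.2 hb (by rw [h, map_zero]; exact zero_lt_one)
  have hX := skew_coord F E c hcδ v hT₀d b
  have hXu := isUnit_det_coord F E v hδ hb0
  have hXi := skew_inv (conjLocal E c v) hXu hX
  have hXn := skew_neg F E c v 1 hXi
  have hδw' : ∀ w : PlacesOver E v, Valued.v ((δ⁻¹ : E) : w.1.adicCompletion E) = 1 := fun w => by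
    have h := hδw w
    rw [HeightOneSpectrum.adicCompletion.valued_coe] at h ⊢
    rw [map_inv₀, h, inv_one]
  have hbi : Valued.v b⁻¹ ≤ 1 := by rw [map_inv₀]; exact inv_le_one_of_one_le₀ hb
  have hXint : ∀ w : PlacesOver E v, IsIntegralAt F E v w (Matrix.of fun _ _ : Fin 1 => toLocalRing E v b * algebraMap E (LocalRing E v) δ)⁻¹ :=
    fun w => by rw [coord_inv F E v hδ hb0]; exact (isIntegralAt_coord_iff F E v w (hδw' w) b⁻¹).2 hbi
  refine ⟨_, isSiegelDelta_pElem F E c hcδ hδ hd v 1 hT₀ hJD _ hX hXu hXn, fun w => ?_,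
    IsSphericalSection.apply_weylDelta_mul_nElem F E c hcδ hδ hd v 1 hT₀ hJD χv s hφ _ hX hXu hXi hXn h2 hXint⟩
  rw [detDelta_pElem F E c v 1 hJD _ hX hXu hXn w, coord_inv F E v hδ hb0, Matrix.det_neg, Matrix.det_fin_one, Matrix.of_apply, Fintype.card_fin,
    pow_one, neg_one_mul, Pi.neg_apply, coord_apply]

end Summit.HodgeConjecture.HodgeConjecture.Cruxes.HLiu418.K2LiuUnipDeltaRankOneCoordinates

end
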